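import Summits.ResolutionOfSingularities.ResolutionOfSingularities.Theorems.PAlterationPialtNormalizationIn
import Summits.ResolutionOfSingularities.ResolutionOfSingularities.Theorems.PAlterationPicoverOfNormalizationIn
import Summits.ResolutionOfSingularities.ResolutionOfSingularities.Theorems.PAlterationPicoverFunctionFieldRadicial
import Summits.ResolutionOfSingularities.ResolutionOfSingularities.Theorems.PAlterationPialtNormalProjective
import Literature.AlgebraicGeometry.Resolution.RegularLocalRingsNormal
import HarnessLib

/-!
# `Pialt` (crux stmt-ResolutionOfSingularities-0555): the function-field form is an equivalence

Companion to `PAlterationPialtNormalizationIn.lean` (`pialt_of_forall_normal_exists_hasResolution_normalizationIn`: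
`Pialt` follows if every normal variety `X` over a field of characteristic `p` has a finite purely
inseparable extension `L ⊇ K(X)` whose normalisation `X^L` is resolvable), landed
`--supports stmt-ResolutionOfSingularities-0555` (does not close the item). Here the CONVERSE, so
that the crux is literally EQUIVALENT to this function-field statement
(`pialt_iff_forall_normal_exists_hasResolution_normalizationIn`):

* `isIntegrallyClosed_stalk_normalization_of_normal` — **the relative normalisation of `Y` in a
  NORMAL integral `X` (along a dominant qcqs `f : X → Y`) is normal**: over an affine `U ⊆ Y` it
  is `Spec` of the integral closure `C` of `Γ(Y, U)` in `B = Γ(X, f⁻¹U)`; `B` is an integrally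
  closed domain (sections of a normal integral scheme are integrally closed in `K(X)`), so `C`,
  being integrally closed in `B`, is integrally closed, and so are its localisations;
* `hasResolution_normalizationIn_functionFieldOver` — for `h : N → X` finite dominant with `N`
  NORMAL integral and `X` integral locally of finite type over a field, a resolution of `N` gives
  one of `X^{K(N)}`: the comparison map `X^{K(N)} → N` (universal property of the relative
  normalisation) is integral, dominant and an isomorphism on function fields, hence an
  isomorphism onto the normal `N` ("finite birational onto normal is an isomorphism");
* `exists_hasResolution_normalizationIn_of_pialtConclusion` — given a purely inseparable regular
  alteration `g : X₁ → X` of a normal variety `X` (char `p`), the normalisation `N` of `X` in `X₁`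
  is normal (first bullet, `X₁` regular hence normal), finite and radicial over `X` (E. Noether;
  normality of `X`), resolved by `X₁` (Zariski's Main Theorem), so `L := K(N)` is a finite purely
  inseparable extension of `K(X)` with `X^L ≅ N` resolvable.

Sources: Q. Liu, *Algebraic Geometry and Arithmetic Curves* (2002), 4.1.22–4.1.27; A. J. de Jong,
Publ. Math. IHÉS 83 (1996), 4.16, 4.20–4.21; M. Temkin, J. Algebra 373 (2013), §1.3;
Stacks Project, Tags 035E–035Q, 0BXR, 03H0.
-/

noncomputable section

set_option linter.dupNamespace false -- mandated namespace of this single-conjunct summit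

namespace Summit.ResolutionOfSingularities.ResolutionOfSingularities.Theorems

open CategoryTheory AlgebraicGeometry TopologicalSpace Opposite
open Literature.AlgebraicGeometry.Resolution Literature.AlgebraicGeometry.Motives
open Literature.AlgebraicGeometry.Motives.RatFn
open Summit.ResolutionOfSingularities.ResolutionOfSingularities.Theorems.Picover.OfNormalizationIn
open Summit.ResolutionOfSingularities.ResolutionOfSingularities.Theorems.Picover.FunctionFieldNormalizationIn
open Summit.ResolutionOfSingularities.ResolutionOfSingularities.Theorems.Picover.FunctionFieldRadicial
open Summit.ResolutionOfSingularities.ResolutionOfSingularities.Theses.PAlteration (Pialt)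

universe u

/-! ## The relative normalisation in a normal scheme is normal -/

section NormalNormalization

/-- The sections of a normal integral scheme over a non-empty open form an integrally closed
domain: they are integrally closed in `K(X)` (`isIntegrallyClosedIn_sections`), into which they
embed. [folklore] -/
theorem isIntegrallyClosed_sections_of_normal {X : Scheme.{u}} [IsIntegral X]
    (hN : ∀ x : X, IsIntegrallyClosed (X.presheaf.stalk x)) (V : X.Opens) [Nonempty V] :
    IsIntegrallyClosed Γ(X, V) := by
  haveI := isIntegrallyClosedIn_sections hN V
  haveI : FaithfulSMul Γ(X, V) X.functionField :=
    (faithfulSMul_iff_algebraMap_injective _ _).mpr (X.germToFunctionField_injective V)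
  exact IsIntegrallyClosed.of_isIntegrallyClosedIn Γ(X, V) X.functionField

/-- The integral closure of a ring `A` in an integrally closed domain `B` is an integrally closed
domain: it is integrally closed in `B` (Mathlib), and `B` in its fraction field. [folklore] -/
theorem isIntegrallyClosed_integralClosure {A B : Type*} [CommRing A] [CommRing B] [IsDomain B]
    [Algebra A B] [IsIntegrallyClosed B] : IsIntegrallyClosed (integralClosure A B) := by
  haveI : FaithfulSMul (integralClosure A B) B :=
    (faithfulSMul_iff_algebraMap_injective _ _).mpr Subtype.val_injective
  exact IsIntegrallyClosed.of_isIntegrallyClosed_of_isIntegrallyClosedIn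
    (R := integralClosure A B) (S := B)

variable {X Y : Scheme.{u}} [IsIntegral X] (f : X ⟶ Y) [IsDominant f] [QuasiCompact f]
  [QuasiSeparated f]

/-- **The normalisation of `Y` in a normal integral `X` is normal** (Liu 2002, 4.1.22–4.1.25 in
the relative setting; Stacks 035L): for a dominant qcqs `f : X → Y` of integral schemes with all
local rings of `X` integrally closed, all local rings of `f.normalization` are integrally closed —
over an affine open `U ⊆ Y` the normalisation is `Spec C`, `C` the integral closure of `Γ(Y, U)`
in the integrally closed domain `Γ(X, f⁻¹U)` (`isIntegrallyClosed_integralClosure`), and the local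
rings are localisations of `C` (`isIntegrallyClosed_stalk_of_isAffineOpen`).
[cite: StacksProject, Tag 035L] -/
theorem isIntegrallyClosed_stalk_normalization_of_normal
    (hN : ∀ x : X, IsIntegrallyClosed (X.presheaf.stalk x)) (y : f.normalization) :
    IsIntegrallyClosed (f.normalization.presheaf.stalk y) := by
  -- an affine open `U ∋ h(y)` of `Y`, `h : f.normalization → Y`
  obtain ⟨_, ⟨U, hUaff, rfl⟩, hyU, -⟩ :=
    Y.isBasis_affineOpens.exists_subset_of_mem_open (Set.mem_univ (f.fromNormalization y))
      isOpen_univ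
  have hW : IsAffineOpen (f.fromNormalization ⁻¹ᵁ U) := hUaff.preimage f.fromNormalization
  -- `f⁻¹U` is a non-empty open of the normal integral `X`
  haveI : Nonempty (f ⁻¹ᵁ U) := by
    obtain ⟨x', hx'⟩ := f.denseRange.exists_mem_open U.isOpen ⟨_, hyU⟩
    exact ⟨⟨x', hx'⟩⟩
  letI := (f.app U).hom.toAlgebra
  haveI : IsIntegrallyClosed Γ(X, f ⁻¹ᵁ U) := isIntegrallyClosed_sections_of_normal hN _
  haveI : IsIntegrallyClosed (integralClosure Γ(Y, U) Γ(X, f ⁻¹ᵁ U)) :=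
    isIntegrallyClosed_integralClosure
  have hic : IsIntegrallyClosed Γ(f.normalization, f.fromNormalization ⁻¹ᵁ U) :=
    IsIntegrallyClosed.of_equiv (f.normalizationObjIso hUaff).commRingCatIsoToRingEquiv.symm
  exact isIntegrallyClosed_stalk_of_isAffineOpen hW hic y hyU

end NormalNormalization

/-! ## The normalisation of `X` in `K(N)` is `N`, for `N → X` finite with `N` normal -/

section Comparison

/-- **The normalisation of `X` in `K(N)` is `N`, for `h : N → X` finite dominant with `N`
normal** (de Jong 1996, 4.16/4.20: "finite birational onto normal is an isomorphism"): for
integral schemes `N`, `X` with `X` locally of finite type over a field, the comparison map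
`φ : X^{K(N)} → N` (universal property of the relative normalisation,
`Picover.OfNormalizationIn.exists_comparison`; `φ ≫ h = ι`, and `Spec K(N) → X^{K(N)} → N` is the
generic point) is integral, dominant, and an isomorphism on function fields
(`K(X^{K(N)}) ≃ K(N)` over `K(X)`, `stub_functionField_normalizationIn`), hence an isomorphism
over the normal `N` (`isIso_morphismRestrict_of_isIntegralHom_of_normal`).
[cite: DeJong1996, proof of Lemma 4.20, p. 73] -/
theorem exists_isIso_comparison_of_normal (k : Type) [Field k] (X N : Scheme.{0})
    [IsIntegral X] [IsIntegral N] (f : X ⟶ Spec (.of k)) [LocallyOfFiniteType f] (h : N ⟶ X)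
    [IsFinite h] [IsDominant h] (hNn : ∀ y : N, IsIntegrallyClosed (N.presheaf.stalk y)) :
    ∃ φ : normalizationIn X (FunctionFieldOver h) ⟶ N, IsIso φ ∧
      φ ≫ h = normalizationInι X (FunctionFieldOver h) ∧
      (fromSpecExtension X (FunctionFieldOver h)).toNormalization ≫ φ = fromSpecFunctionField N := by
  -- `K(N)/K(X)` is finite, so `K(X^{K(N)}) ≃ K(N)` over `K(X)` is available
  obtain ⟨_, ⟨V, hVaff, rfl⟩, hξV, -⟩ :=
    X.isBasis_affineOpens.exists_subset_of_mem_open (Set.mem_univ (genericPoint X)) isOpen_univ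
  haveI : FiniteDimensional X.functionField (FunctionFieldOver h) :=
    FunctionFieldOver.finiteDimensional h hVaff hξV
  obtain ⟨e, he⟩ := stub_functionField_normalizationIn X (FunctionFieldOver h)
  obtain ⟨φ, hcomp, htn, hint⟩ := exists_comparison h
  haveI := hint
  refine ⟨φ, ?_, hcomp, htn⟩
  -- `φ` is dominant: `Spec K(N) → N` factors through it
  haveI : IsDominant φ := by
    have h0 : IsDominant (fromSpecFunctionField N) := inferInstance
    have h1 : IsDominant ((fromSpecExtension X (FunctionFieldOver h)).toNormalization ≫ φ) := by
      rw [htn]; exact h0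
    exact IsDominant.of_comp (fromSpecExtension X (FunctionFieldOver h)).toNormalization φ
  -- `ι^♯ = φ^♯ ∘ h^♯` on function fields
  have hc : RatFn.functionFieldMap (normalizationInι X (FunctionFieldOver h)) =
      (RatFn.functionFieldMap φ).comp (RatFn.functionFieldMap h) :=
    functionFieldMap_eq_comp_of_eq h φ _ hcomp.symm
  -- `ψ := e ∘ φ^♯ : K(N) → K(N)` is a `K(X)`-algebra endomorphism of the finite extension
  -- `K(N)/K(X)`, hence bijective; so `φ^♯` is bijective
  let ψ₀ : FunctionFieldOver h →+* FunctionFieldOver h :=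
    e.toRingHom.comp (RatFn.functionFieldMap φ)
  have hψ₀ : ∀ r : X.functionField,
      ψ₀ (algebraMap X.functionField (FunctionFieldOver h) r) =
        algebraMap X.functionField (FunctionFieldOver h) r := by
    intro r
    have h1 := RingHom.congr_fun he r
    rw [hc] at h1
    exact h1
  let ψ : FunctionFieldOver h →ₐ[X.functionField] FunctionFieldOver h :=
    { ψ₀ with commutes' := hψ₀ }
  have hψ : Function.Bijective ψ := Algebra.IsAlgebraic.algHom_bijective ψ
  have hbij : Function.Bijective (RatFn.functionFieldMap φ) := by
    have h2 : Function.Bijective (fun x => e.symm (e (RatFn.functionFieldMap φ x))) :=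
      e.symm.bijective.comp hψ
    simpa using h2
  -- hence the stalk map of `φ` at the generic point is an isomorphism
  have hstalk : IsIso (φ.stalkMap (genericPoint _)) :=
    isIso_stalkMap_genericPoint_of_bijective φ hbij
  -- `N` is normal, so `φ` is an isomorphism over all of `N`
  have hiso : IsIso (φ ∣_ (⊤ : N.Opens)) :=
    isIso_morphismRestrict_of_isIntegralHom_of_normal φ hstalk ⊤ fun y _ => hNn y
  have key : MorphismProperty.isomorphisms Scheme φ :=
    IsZariskiLocalAtTarget.of_iSup_eq_top (P := MorphismProperty.isomorphisms Scheme)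
      (fun _ : Unit => (⊤ : N.Opens)) (by simp) fun _ =>
        (MorphismProperty.isomorphisms.iff _).mpr hiso
  exact (MorphismProperty.isomorphisms.iff φ).mp key

/-- **A resolution of a normal finite cover `N → X` is a resolution of `X^{K(N)}`**: with
`φ : X^{K(N)} ≅ N` from `exists_isIso_comparison_of_normal`, resolutions transport along `φ⁻¹`.
[cite: DeJong1996, proof of Lemma 4.20, p. 73] -/
theorem hasResolution_normalizationIn_functionFieldOver (k : Type) [Field k] (X N : Scheme.{0})
    [IsIntegral X] [IsIntegral N] (f : X ⟶ Spec (.of k)) [LocallyOfFiniteType f] (h : N ⟶ X)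
    [IsFinite h] [IsDominant h] (hNn : ∀ y : N, IsIntegrallyClosed (N.presheaf.stalk y))
    (hres : Scheme.HasResolution N) :
    Scheme.HasResolution (normalizationIn X (FunctionFieldOver h)) := by
  obtain ⟨φ, hφ, -, -⟩ := exists_isIso_comparison_of_normal k X N f h hNn
  haveI := hφ
  exact Scheme.HasResolution.of_iso (inv φ) hres

end Comparison

/-! ## From a purely inseparable regular alteration to a resolvable `X^L` -/

/-- **A purely inseparable regular alteration of a normal variety yields a finite purely
inseparable `L/K(X)` with `X^L` resolvable.** Over a field of characteristic `p`, let `X` be a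
NORMAL integral separated scheme of finite type with a proper surjective `g : X₁ → X`, `X₁`
integral regular, finite and universally injective over a dense open. Let `N` be the
normalisation of `X` in `X₁` and `L := K(N)`: then `N → X` is finite (E. Noether) and radicial
(`X` normal, `K(X₁)/K(X)` purely inseparable), so `L/K(X)` is finite purely inseparable; `N` is
normal (`isIntegrallyClosed_stalk_normalization_of_normal`, `X₁` being regular hence normal) and
resolved by `X₁` (Zariski's Main Theorem), so `X^L ≅ N` has a resolution
(`hasResolution_normalizationIn_functionFieldOver`). [cite: Temkin2013, Rem. 1.3.5(i)] -/
theorem exists_hasResolution_normalizationIn_of_pialtConclusion {p : ℕ} (hp : p.Prime)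
    (k : Type) [Field k] [CharP k p] (X : Scheme.{0}) (f : X ⟶ Spec (.of k)) [IsSeparated f]
    [LocallyOfFiniteType f] [QuasiCompact f] [IsIntegral X]
    (hN : ∀ x : X, IsIntegrallyClosed (X.presheaf.stalk x))
    (hPI : ∃ (X₁ : Scheme.{0}) (g : X₁ ⟶ X), IsProper g ∧ IsIntegral X₁ ∧ Scheme.IsRegular X₁ ∧
      Function.Surjective g.base ∧ ∃ U : X.Opens, Dense (U : Set X) ∧ IsFinite (g ∣_ U) ∧
        UniversallyInjective (g ∣_ U)) :
    ∃ (L : Type) (_ : Field L) (_ : Algebra X.functionField L),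
      FiniteDimensional X.functionField L ∧ IsPurelyInseparable X.functionField L ∧
        Scheme.HasResolution (normalizationIn X L) := by
  haveI : Fact p.Prime := ⟨hp⟩
  obtain ⟨X₁, g, hgprop, hint₁, hreg₁, hsurj, U, hUd, hfinU, huiU⟩ := hPI
  haveI := hgprop
  haveI := hint₁
  haveI : IsDominant g := ⟨hsurj.denseRange⟩
  -- an affine open `V ⊆ U` of `X` containing the generic point
  have hξU : genericPoint X ∈ U :=
    ((genericPoint_spec X).mem_open_set_iff U.isOpen).mpr (by simpa using hUd.nonempty)
  obtain ⟨_, ⟨V, hVaff, rfl⟩, hξV, hVU⟩ :=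
    X.isBasis_affineOpens.exists_subset_of_mem_open hξU U.isOpen
  haveI : IsFinite (g ∣_ V) := morphismRestrict_of_le g (P := @IsFinite) hVU hfinU
  haveI : UniversallyInjective (g ∣_ V) :=
    morphismRestrict_of_le g (P := @UniversallyInjective) hVU huiU
  have hVaff' : IsAffineOpen (g ⁻¹ᵁ V) :=
    isAffineOpen_preimage_of_isAffineHom_morphismRestrict g hVaff
  have hfin : (g.app V).hom.Finite :=
    (IsFinite.SpecMap_iff _).mp
      ((morphismRestrict_iff_specMap_app g hVaff hVaff' (P := @IsFinite)).mp ‹_›)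
  haveI : UniversallyInjective (Spec.map (g.app V)) :=
    (morphismRestrict_iff_specMap_app g hVaff hVaff' (P := @UniversallyInjective)).mp ‹_›
  -- the function field extension `K(X₁)/K(X)` is finite and purely inseparable
  haveI : FiniteDimensional X.functionField (FunctionFieldOver g) :=
    finiteDimensional_functionFieldOver_of_finite g hξV hVaff' hfin
  haveI : IsPurelyInseparable X.functionField (FunctionFieldOver g) :=
    isPurelyInseparable_functionFieldOver_of_universallyInjective g hξV hVaff'
  haveI : CharP X.functionField p := by
    let ι : k →+* X.functionField :=
      (X.presheaf.germ ⊤ (genericPoint X) trivial).hom.comp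
        (f.appTop.hom.comp (Scheme.ΓSpecIso (.of k)).inv.hom)
    exact (ι.charP_iff_charP p).mp ‹_›
  -- the normalisation `N := g.normalization` of `X` in `X₁`, `g = g' ≫ h`
  haveI hfinh : IsFinite g.fromNormalization :=
    isFinite_fromNormalization_of_finiteDimensional g f
  haveI hui : UniversallyInjective g.fromNormalization :=
    universallyInjective_fromNormalization g hN p
  haveI : IsDominant g.fromNormalization := by
    have : IsDominant (g.toNormalization ≫ g.fromNormalization) := by
      rw [g.toNormalization_fromNormalization]; infer_instance
    exact IsDominant.of_comp g.toNormalization g.fromNormalization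
  have hne : ((g ⁻¹ᵁ V : X₁.Opens) : Set X₁).Nonempty :=
    ⟨genericPoint X₁, genericPoint_mem_preimage g hξV⟩
  have hres : Scheme.HasResolution g.normalization :=
    hasResolution_normalization_of_isRegular g hreg₁ V hne
  -- `N` is normal: `X₁` is regular, hence normal
  have hX₁n : ∀ x : X₁, IsIntegrallyClosed (X₁.presheaf.stalk x) := fun x =>
    haveI := hreg₁ x
    isIntegrallyClosed_of_isRegularLocalRing (X₁.presheaf.stalk x)
  have hNn : ∀ y : g.normalization, IsIntegrallyClosed (g.normalization.presheaf.stalk y) :=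
    isIntegrallyClosed_stalk_normalization_of_normal g hX₁n
  -- `L := K(N)` over `K(X)`
  refine ⟨FunctionFieldOver g.fromNormalization, inferInstance, inferInstance, ?_, ?_, ?_⟩
  · exact FunctionFieldOver.finiteDimensional g.fromNormalization hVaff hξV
  · exact stub_functionFieldRadicial g.normalization X g.fromNormalization
  · exact hasResolution_normalizationIn_functionFieldOver k X g.normalization f
      g.fromNormalization hNn hres

/-- **`Pialt` in function-field form (equivalence)**: `Pialt` holds if and only if, for every
prime `p`, every field `k` of characteristic `p` and every NORMAL integral separated `k`-scheme
`X` of finite type, there is a finite purely inseparable extension `L ⊇ K(X)` such that the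
normalisation `X^L` of `X` in `L` admits a resolution of singularities
(⇐: `pialt_of_forall_normal_exists_hasResolution_normalizationIn`;
⇒: `pialt_iff_forall_normal` and `exists_hasResolution_normalizationIn_of_pialtConclusion`). So the
positive-characteristic Abramovich–Oort conjecture is exactly: every normal variety becomes
resolvable after passing to its normalisation in ONE suitable finite purely inseparable extension
of its function field. [cite: Temkin2013, Conj. 1.3.1, Thm. 1.3.2, Rem. 1.3.5(i)] -/
theorem pialt_iff_forall_normal_exists_hasResolution_normalizationIn :
    Pialt ↔ ∀ p : ℕ, p.Prime → ∀ (k : Type) [Field k] [CharP k p] (X : Scheme.{0})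
      (f : X ⟶ Spec (.of k)), IsSeparated f → LocallyOfFiniteType f → QuasiCompact f →
        [IsIntegral X] → (∀ x : X, IsIntegrallyClosed (X.presheaf.stalk x)) →
          ∃ (L : Type) (_ : Field L) (_ : Algebra X.functionField L),
            FiniteDimensional X.functionField L ∧ IsPurelyInseparable X.functionField L ∧
              Scheme.HasResolution (normalizationIn X L) := by
  refine ⟨fun hP p hp k _ _ X f hs hl hq hi hN => ?_,
    pialt_of_forall_normal_exists_hasResolution_normalizationIn⟩
  haveI := hs; haveI := hl; haveI := hq
  exact exists_hasResolution_normalizationIn_of_pialtConclusion hp k X f hN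
    ((pialt_iff_forall_normal.mp hP) p hp k X f hs hl hq hi hN)


/-- **`Pialt` in function-field form on normal projective varieties**: `Pialt` holds if and only
if, for every prime `p`, every field `k` of characteristic `p` and every NORMAL integral PROJECTIVE
`k`-scheme `X`, there is a finite purely inseparable extension `L ⊇ K(X)` such that the
normalisation `X^L` (again a normal projective variety: `isProjectiveOver_normalizationIn`,
`isIntegrallyClosed_stalk_normalizationIn`) admits a resolution of singularities — combine
`pialt_iff_forall_normal_isProjectiveOver` with `pialtConclusion_of_hasResolution_normalizationIn`
and `exists_hasResolution_normalizationIn_of_pialtConclusion`.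
[cite: Temkin2013, Conj. 1.3.1; DeJong1996, 4.6–4.7, 4.16] -/
theorem pialt_iff_forall_normal_isProjectiveOver_exists_hasResolution_normalizationIn :
    Pialt ↔ ∀ p : ℕ, p.Prime → ∀ (k : Type) [Field k] [CharP k p] (X : Scheme.{0})
      (f : X ⟶ Spec (.of k)), [IsIntegral X] →
        Literature.AlgebraicGeometry.Motives.IsProjectiveOver (Over.mk f) →
          (∀ x : X, IsIntegrallyClosed (X.presheaf.stalk x)) →
            ∃ (L : Type) (_ : Field L) (_ : Algebra X.functionField L),
              FiniteDimensional X.functionField L ∧ IsPurelyInseparable X.functionField L ∧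
                Scheme.HasResolution (normalizationIn X L) := by
  rw [pialt_iff_forall_normal_isProjectiveOver]
  refine ⟨fun hP p hp k _ _ X f hi hproj hN => ?_, fun H p hp k _ _ X f hi hproj hN => ?_⟩
  · haveI : IsProper f := Literature.AlgebraicGeometry.Motives.IsProjectiveOver.isProper hproj
    exact exists_hasResolution_normalizationIn_of_pialtConclusion hp k X f hN
      (hP p hp k X f hi hproj hN)
  · haveI := hi
    haveI : IsProper f := Literature.AlgebraicGeometry.Motives.IsProjectiveOver.isProper hproj
    obtain ⟨L, _, _, hfd, hpi, hres⟩ := H p hp k X f hproj hN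
    haveI := hfd; haveI := hpi
    exact pialtConclusion_of_hasResolution_normalizationIn hp k X f hN L hres

end Summit.ResolutionOfSingularities.ResolutionOfSingularities.Theorems

end
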